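import Mathlib
import HarnessLib
import Literature.MathematicalPhysics.KineticTheory.HardSphereEuler
import Literature.MathematicalPhysics.KineticTheory.BackwardCluster

/-!
# The link-count tail from a first-moment bound on simple collision chains (reduction of the stub
`stub_linkCountTail` of the line `Sketch` for the crux `RelayRaceLocality.GibbsLightCone`,
stmt-AtomisticToContinuum-12501)

Helper file (`--supports stmt-AtomisticToContinuum-12501`). The registered stub
`stub_linkCountTail` (LINK-COUNT TAIL) asks: under the invariant Gibbs law of `N + 1` hard spheres
of diameter `ε_N = σ (N+1)^{-1/3}` on `𝕋³`, the probability that SOME simple collision chain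
`q 0, …, q k = p` into the tagged particle `p`, with strictly increasing hand-over times inside the
window `[0, M τ_N]` (`τ_N = ℓ_N / √θ`, `ℓ_N = (N+1)^{-1/3} / σ²`), has `k ε_N > λ M ℓ_N` — i.e.
MORE THAN `λ M / σ³` LINKS — is `≤ C e^{-cM}` for `1 ≤ M ≤ K log(N+2)`, eventually in `N`.

This file PROVES that tail from the natural currency of every lineage / spine expansion, an
EXPONENTIAL FIRST-MOMENT BOUND ON SIMPLE CHAIN COUNTS (`linkCountTail_of_simpleChainCountBound`,
hypothesis `hCount`): the expected number of label sequences `q : Fin (n+1) → Fin (N+1)`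
(injective, ending at `p`) realised as a collision chain with `n` links over the window is at most
`C₀ e^{c₁ M} ρⁿ` for some `ρ < 1` (the Poisson / lineage heuristic gives `(C M)ⁿ / n! ≤ e^{2CM} 2⁻ⁿ`).
The deduction is a union bound over the number of links `k` (countable) and the label sequences
`q` (finite), the kinematic identity `ε_N / ℓ_N = σ³ ≤ 1` turning `k ε_N > λ M ℓ_N` into `k > λ M`,
and a geometric tail: with `r = max ρ ½`, `λ = (|c₁| + 1) / (-log r)`,
`Σ_{k > λM} |C₀| e^{|c₁| M} rᵏ ≤ |C₀| (1 - r)⁻¹ e^{-M}`.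

The first-moment bound itself is NOT proved here (nor anywhere in print at fixed reduced density
over `K log N` mean free times): it is the cross-time ("seam") input the line isolates.
-/

namespace Summit.AtomisticToContinuum.HydrodynamicLimit.Theorems.LogWindowTaggedTail

open Literature.MathematicalPhysics.KineticTheory Literature.Analysis.FluidPDE MeasureTheory Filter Set

open scoped ENNReal

/-- Kinematics of the thresholds: `λ M ℓ_N < k ε_N` with `ε_N = σ ν`, `ℓ_N = ν / σ²` (`ν > 0`),
`0 < σ ≤ 1`, forces `λ M < k`. [folklore] -/
theorem linkCount_lt_of_threshold {lam M ν σ : ℝ} {k : ℕ} (hν : 0 < ν) (hσ : 0 < σ) (hσ1 : σ ≤ 1)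
    (h : lam * M * (ν / σ ^ 2) < k * (σ * ν)) : lam * M < k := by
  have hσ2 : 0 < σ ^ 2 := by positivity
  have h1 : lam * M / σ ^ 2 * ν < (k * σ) * ν := by
    have e1 : lam * M * (ν / σ ^ 2) = lam * M / σ ^ 2 * ν := by ring
    have e2 : (k : ℝ) * (σ * ν) = (k * σ) * ν := by ring
    rwa [e1, e2] at h
  have h2 : lam * M / σ ^ 2 < k * σ := lt_of_mul_lt_mul_right h1 hν.le
  have h3 : lam * M < k * σ * σ ^ 2 := (div_lt_iff₀ hσ2).1 h2
  have h4 : (k : ℝ) * σ * σ ^ 2 = k * σ ^ 3 := by ring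
  have h5 : (k : ℝ) * σ ^ 3 ≤ k :=
    mul_le_of_le_one_right (Nat.cast_nonneg k) (pow_le_one₀ hσ.le hσ1)
  linarith

/-- The geometric tail with an exponential prefactor: for `0 < r < 1`, `λ = (b + 1) / (-log r)` and
an integer `n₀ > λ M`, `e^{bM} r^{n₀} ≤ e^{-M}`. [folklore] -/
theorem exp_mul_pow_le_exp_neg {r b M : ℝ} {n₀ : ℕ} (hr0 : 0 < r) (hr1 : r < 1)
    (hn₀ : (b + 1) / (-Real.log r) * M < n₀) :
    Real.exp (b * M) * r ^ n₀ ≤ Real.exp (-M) := by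
  have hlog : Real.log r < 0 := Real.log_neg hr0 hr1
  have hlog' : Real.log r ≠ 0 := hlog.ne
  have hpow : r ^ n₀ = Real.exp (n₀ * Real.log r) := by
    rw [← Real.log_pow, Real.exp_log (pow_pos hr0 n₀)]
  rw [hpow, ← Real.exp_add]
  refine Real.exp_le_exp.2 ?_
  have h1 : (n₀ : ℝ) * Real.log r < (b + 1) / (-Real.log r) * M * Real.log r :=
    mul_lt_mul_of_neg_right hn₀ hlog
  have h2 : (b + 1) / (-Real.log r) * M * Real.log r = -((b + 1) * M) := by
    field_simp
  linarith

/-- **THE LINK-COUNT TAIL FROM A FIRST-MOMENT BOUND ON SIMPLE CHAIN COUNTS.** If, under the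
invariant Gibbs law, the expected number of injective label sequences `q 0, …, q n = p` realised as a
collision chain with `n` links into `p` over the window `[0, M τ_N]` (strictly increasing hand-over
times) is at most `C₀ e^{c₁ M} ρⁿ` with `0 ≤ ρ < 1`, for `1 ≤ M ≤ K log(N+2)` and eventually in `N`
(hypothesis `hCount`, the cross-time input), then the registered stub `stub_linkCountTail` holds:
some simple chain into `p` has more than `λ M ℓ_N / ε_N` links with probability `≤ C e^{-cM}`.
Union bound over `(k, q)`, `ε_N / ℓ_N = σ³ ≤ 1`, geometric tail. [folklore] -/
theorem linkCountTail_of_simpleChainCountBound :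
    (∀ a θ : ℝ, 0 < a → 0 < θ → ∃ σ₀ : ℝ, 0 < σ₀ ∧ ∃ C₀ c₁ ρ : ℝ, 0 ≤ ρ ∧ ρ < 1 ∧
      ∀ K : ℝ, 0 < K → ∀ σ : ℝ, 0 < σ → σ < σ₀ →
      ∀ Φ : (N : ℕ) → HardSphereFlow (Torus.geometry (Fin 3)) (hsDiameter σ N) (N + 1),
      ∀ᶠ N in atTop, ∀ p : Fin (N + 1), ∀ M : ℝ, 1 ≤ M → M ≤ K * Real.log ((N : ℝ) + 2) →
        ∀ n : ℕ, ∑ q : Fin (n + 1) → Fin (N + 1),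
          localGibbsLaw σ (fun _ => a) (fun _ => 0) (fun _ => θ) N (Φ N)
            {z | q (Fin.last n) = p ∧ Function.Injective q ∧ ∃ T : Fin (n + 2) → ℝ, Monotone T ∧
                StrictMono (fun m : Fin n => T (Fin.castSucc (Fin.succ m))) ∧ T 0 = 0 ∧
                T (Fin.last (n + 1)) = M * (((N + 1 : ℕ) : ℝ) ^ (-(1 / 3 : ℝ)) / σ ^ 2 / Real.sqrt θ) ∧
                ∀ m : Fin n, s(q (Fin.castSucc m), q (Fin.succ m)) ∈
                  contactPairSet (Torus.geometry (Fin 3)) (hsDiameter σ N)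
                    ((Φ N).flow (T (Fin.castSucc (Fin.succ m))) z)}
          ≤ ENNReal.ofReal (C₀ * Real.exp (c₁ * M) * ρ ^ n)) →
    ∀ a θ : ℝ, 0 < a → 0 < θ → ∃ σ₀ : ℝ, 0 < σ₀ ∧ ∃ lam c C : ℝ, 0 < c ∧ ∀ K : ℝ, 0 < K →
      ∀ σ : ℝ, 0 < σ → σ < σ₀ →
      ∀ Φ : (N : ℕ) → HardSphereFlow (Torus.geometry (Fin 3)) (hsDiameter σ N) (N + 1),
      ∀ᶠ N in atTop, ∀ p : Fin (N + 1), ∀ M : ℝ, 1 ≤ M → M ≤ K * Real.log ((N : ℝ) + 2) →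
        localGibbsLaw σ (fun _ => a) (fun _ => 0) (fun _ => θ) N (Φ N)
          {z | ∃ (k : ℕ) (q : Fin (k + 1) → Fin (N + 1)) (T : Fin (k + 2) → ℝ),
              q (Fin.last k) = p ∧ Function.Injective q ∧ Monotone T ∧
              StrictMono (fun m : Fin k => T (Fin.castSucc (Fin.succ m))) ∧ T 0 = 0 ∧
              T (Fin.last (k + 1)) = M * (((N + 1 : ℕ) : ℝ) ^ (-(1 / 3 : ℝ)) / σ ^ 2 / Real.sqrt θ) ∧
              (∀ m : Fin k, s(q (Fin.castSucc m), q (Fin.succ m)) ∈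
                contactPairSet (Torus.geometry (Fin 3)) (hsDiameter σ N)
                  ((Φ N).flow (T (Fin.castSucc (Fin.succ m))) z)) ∧
              lam * M * (((N + 1 : ℕ) : ℝ) ^ (-(1 / 3 : ℝ)) / σ ^ 2) < k * hsDiameter σ N}
          ≤ ENNReal.ofReal (C * Real.exp (-c * M)) := by
  intro hCount a θ ha hθ
  obtain ⟨σ₁, hσ₁, C₀, c₁, ρ, hρ0, hρ1, H⟩ := hCount a θ ha hθ
  -- constants
  set r : ℝ := max ρ (1 / 2) with hr
  have hr0 : 0 < r := lt_of_lt_of_le one_half_pos (le_max_right _ _)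
  have hr1 : r < 1 := max_lt hρ1 one_half_lt_one
  have hρr : ρ ≤ r := le_max_left _ _
  have hlogr : Real.log r < 0 := Real.log_neg hr0 hr1
  set b : ℝ := |c₁| with hb
  set lam : ℝ := (b + 1) / (-Real.log r) with hlam
  have hlam0 : 0 ≤ lam := div_nonneg (by positivity) (neg_nonneg.2 hlogr.le)
  refine ⟨min σ₁ 1, lt_min hσ₁ one_pos, lam, 1, |C₀| * (1 - r)⁻¹, one_pos, ?_⟩
  intro K hK σ hσ hσlt Φ
  have hσσ₁ : σ < σ₁ := lt_of_lt_of_le hσlt (min_le_left _ _)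
  have hσ1 : σ ≤ 1 := (lt_of_lt_of_le hσlt (min_le_right _ _)).le
  filter_upwards [H K hK σ hσ hσσ₁ Φ] with N hN p M hM hMK
  -- abbreviations
  set ν : ℝ := ((N + 1 : ℕ) : ℝ) ^ (-(1 / 3 : ℝ)) with hν
  set W : ℝ := M * (ν / σ ^ 2 / Real.sqrt θ) with hW
  set P := localGibbsLaw σ (fun _ => a) (fun _ => 0) (fun _ => θ) N (Φ N) with hP
  have hνpos : 0 < ν := Real.rpow_pos_of_pos (by positivity) _
  have hε : hsDiameter σ N = σ * ν := rfl
  have hM0 : 0 ≤ M := by linarith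
  -- the events of the first-moment bound and their thresholded versions
  set E : (k : ℕ) → (Fin (k + 1) → Fin (N + 1)) → Set (Config (N + 1) (Fin 3) T3) := fun k q =>
    {z | q (Fin.last k) = p ∧ Function.Injective q ∧ ∃ T : Fin (k + 2) → ℝ, Monotone T ∧
        StrictMono (fun m : Fin k => T (Fin.castSucc (Fin.succ m))) ∧ T 0 = 0 ∧
        T (Fin.last (k + 1)) = W ∧
        ∀ m : Fin k, s(q (Fin.castSucc m), q (Fin.succ m)) ∈
          contactPairSet (Torus.geometry (Fin 3)) (hsDiameter σ N)
            ((Φ N).flow (T (Fin.castSucc (Fin.succ m))) z)} with hE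
  set E' : (k : ℕ) → (Fin (k + 1) → Fin (N + 1)) → Set (Config (N + 1) (Fin 3) T3) := fun k q =>
    {z | lam * M * (ν / σ ^ 2) < k * hsDiameter σ N ∧ z ∈ E k q} with hE'
  -- the threshold in links: `λ M ℓ < k ε` forces `λ M < k`, i.e. `n₀ ≤ k`
  set n₀ : ℕ := ⌊lam * M⌋₊ + 1 with hn₀
  have hn₀_gt : lam * M < n₀ := by
    rw [hn₀]
    push_cast
    exact Nat.lt_floor_add_one _
  have hthr : ∀ k : ℕ, lam * M * (ν / σ ^ 2) < k * hsDiameter σ N → n₀ ≤ k := by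
    intro k hk
    rw [hε] at hk
    have hlt : lam * M < k := linkCount_lt_of_threshold hνpos hσ hσ1 hk
    have := (Nat.floor_lt (mul_nonneg hlam0 hM0)).2 hlt
    rw [hn₀]
    omega
  -- the dominating sequence
  set g : ℕ → ℝ := fun k => if n₀ ≤ k then |C₀| * Real.exp (b * M) * r ^ k else 0 with hg
  have hg_nonneg : ∀ k, 0 ≤ g k := by
    intro k
    simp only [hg]
    split_ifs
    · positivity
    · exact le_rfl
  have hg_le : ∀ k, g k ≤ |C₀| * Real.exp (b * M) * r ^ k := by
    intro k
    simp only [hg]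
    split_ifs
    · exact le_rfl
    · positivity
  have hgeom : Summable fun k : ℕ => |C₀| * Real.exp (b * M) * r ^ k :=
    (summable_geometric_of_lt_one hr0.le hr1).mul_left _
  have hg_summ : Summable g := Summable.of_nonneg_of_le hg_nonneg hg_le hgeom
  -- the real bound of the first-moment hypothesis is dominated by `g`
  have hdom : ∀ k : ℕ, n₀ ≤ k → C₀ * Real.exp (c₁ * M) * ρ ^ k ≤ g k := by
    intro k hk
    have hgk : g k = |C₀| * Real.exp (b * M) * r ^ k := by simp [hg, hk]
    rw [hgk]
    have h1 : C₀ * Real.exp (c₁ * M) * ρ ^ k ≤ |C₀| * Real.exp (c₁ * M) * ρ ^ k :=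
      mul_le_mul_of_nonneg_right (mul_le_mul_of_nonneg_right (le_abs_self _) (Real.exp_pos _).le)
        (pow_nonneg hρ0 _)
    have h2 : Real.exp (c₁ * M) ≤ Real.exp (b * M) :=
      Real.exp_le_exp.2 (mul_le_mul_of_nonneg_right (le_abs_self _) hM0)
    have h3 : ρ ^ k ≤ r ^ k := pow_le_pow_left₀ hρ0 hρr k
    calc C₀ * Real.exp (c₁ * M) * ρ ^ k ≤ |C₀| * Real.exp (c₁ * M) * ρ ^ k := h1
      _ ≤ |C₀| * Real.exp (b * M) * r ^ k := by
          gcongr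
  -- per number of links: union over the label sequences
  have hk : ∀ k : ℕ, P (⋃ q : Fin (k + 1) → Fin (N + 1), E' k q) ≤ ENNReal.ofReal (g k) := by
    intro k
    by_cases hth : lam * M * (ν / σ ^ 2) < k * hsDiameter σ N
    · have hle : n₀ ≤ k := hthr k hth
      calc P (⋃ q : Fin (k + 1) → Fin (N + 1), E' k q)
          ≤ ∑ q : Fin (k + 1) → Fin (N + 1), P (E' k q) := measure_iUnion_fintype_le P _
        _ ≤ ∑ q : Fin (k + 1) → Fin (N + 1), P (E k q) :=
            Finset.sum_le_sum fun q _ => measure_mono fun z hz => hz.2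
        _ ≤ ENNReal.ofReal (C₀ * Real.exp (c₁ * M) * ρ ^ k) := hN p M hM hMK k
        _ ≤ ENNReal.ofReal (g k) := ENNReal.ofReal_le_ofReal (hdom k hle)
    · have hempty : (⋃ q : Fin (k + 1) → Fin (N + 1), E' k q) = ∅ := by
        refine Set.eq_empty_of_forall_notMem fun z hz => ?_
        obtain ⟨q, hq⟩ := Set.mem_iUnion.1 hz
        exact hth hq.1
      rw [hempty, measure_empty]
      exact bot_le
  -- the stub event is covered by the thresholded events
  have hsub : {z | ∃ (k : ℕ) (q : Fin (k + 1) → Fin (N + 1)) (T : Fin (k + 2) → ℝ),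
      q (Fin.last k) = p ∧ Function.Injective q ∧ Monotone T ∧
      StrictMono (fun m : Fin k => T (Fin.castSucc (Fin.succ m))) ∧ T 0 = 0 ∧
      T (Fin.last (k + 1)) = W ∧
      (∀ m : Fin k, s(q (Fin.castSucc m), q (Fin.succ m)) ∈
        contactPairSet (Torus.geometry (Fin 3)) (hsDiameter σ N)
          ((Φ N).flow (T (Fin.castSucc (Fin.succ m))) z)) ∧
      lam * M * (ν / σ ^ 2) < k * hsDiameter σ N} ⊆
      ⋃ k : ℕ, ⋃ q : Fin (k + 1) → Fin (N + 1), E' k q := by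
    rintro z ⟨k, q, T, hqk, hinj, hmono, hsm, hT0, hTl, hlink, hdist⟩
    exact Set.mem_iUnion.2 ⟨k, Set.mem_iUnion.2 ⟨q, hdist, hqk, hinj, T, hmono, hsm, hT0, hTl, hlink⟩⟩
  refine le_trans (measure_mono hsub) ?_
  refine le_trans (measure_iUnion_le _) ?_
  refine le_trans (ENNReal.tsum_le_tsum hk) ?_
  rw [← ENNReal.ofReal_tsum_of_nonneg hg_nonneg hg_summ]
  refine ENNReal.ofReal_le_ofReal ?_
  -- the geometric tail
  have hshift := hg_summ.sum_add_tsum_nat_add n₀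
  have hzero : ∑ i ∈ Finset.range n₀, g i = 0 := by
    refine Finset.sum_eq_zero fun i hi => ?_
    have hi' : ¬ n₀ ≤ i := not_le.2 (Finset.mem_range.1 hi)
    simp [hg, hi']
  have htail : ∑' i, g (i + n₀) = |C₀| * Real.exp (b * M) * r ^ n₀ * (1 - r)⁻¹ := by
    have hgi : ∀ i, g (i + n₀) = |C₀| * Real.exp (b * M) * r ^ n₀ * r ^ i := by
      intro i
      have hle : n₀ ≤ i + n₀ := Nat.le_add_left _ _
      simp only [hg, hle, if_true, pow_add]
      ring
    simp_rw [hgi]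
    rw [tsum_mul_left, tsum_geometric_of_lt_one hr0.le hr1]
  rw [← hshift, hzero, zero_add, htail]
  have hkey : Real.exp (b * M) * r ^ n₀ ≤ Real.exp (-M) := exp_mul_pow_le_exp_neg hr0 hr1 hn₀_gt
  have h1r : 0 < (1 - r)⁻¹ := inv_pos.2 (by linarith)
  calc |C₀| * Real.exp (b * M) * r ^ n₀ * (1 - r)⁻¹
      = |C₀| * (1 - r)⁻¹ * (Real.exp (b * M) * r ^ n₀) := by ring
    _ ≤ |C₀| * (1 - r)⁻¹ * Real.exp (-M) :=
        mul_le_mul_of_nonneg_left hkey (mul_nonneg (abs_nonneg _) h1r.le)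
    _ = |C₀| * (1 - r)⁻¹ * Real.exp (-1 * M) := by rw [neg_one_mul]

end Summit.AtomisticToContinuum.HydrodynamicLimit.Theorems.LogWindowTaggedTail
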